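import Summits.ValiantsHypothesis.ValiantsHypothesis.Theorems.KPlusLogSqLawTropicalBMarkedEdgeCoreKOneJ

/-!
# Route «KPlusLogSqLaw», crux `TropicalB` (stmt-ValiantsHypothesis-19771) — MARKED-EDGE sector, NESTED-TRIANGLE CORE, ALL sizes:
# INVERSION DUALITY of realisations, and the dual (Regime II) form of THEOREM K1-J

HONEST FRAMING.  Helper file (cell `pub-symmetroid`, seat val-sym-trop-p4 (g21), 2026-08-29; `--supports stmt-ValiantsHypothesis-19771 --as
helper`).  The self-duality used throughout this seat's memo HOME/val-sym-trop-p4/g21/RIGIDITY-g21.md §1: inverting all covers and transposing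
the arc data turns a realisation into a realisation with the same loop patterns (`isMax_inv`); under it «reachable from b0» and «reaching b0»
are exchanged and every mark `b_k` trades places with `σZ⁻¹ b_k`.  Applied to `core_K1J` (p697066) this gives the Regime-II twin
`core_K1J_inv` for free.  Nothing here proves the nested-triangle law; nothing concerns `TropicalB` in its window, `WeakLifting`, the doors,
`MatrixDescartes` (stmt-ValiantsHypothesis-18050) or VP ≠ VNP.
-/

set_option linter.dupNamespace false
set_option autoImplicit false

namespace Summit.ValiantsHypothesis.ValiantsHypothesis.Theorems.KPlusLogSqLaw
namespace MarkedEdge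
namespace Core

open Finset

variable {V : Type*} [Fintype V] [DecidableEq V]

omit [DecidableEq V] in
/-- Re-indexing a score along a cover: `∑ i, f (τ i) i = ∑ j, f j (τ⁻¹ j)`. [folklore] -/
theorem sum_transpose (f : V → V → ℤ) (τ : Equiv.Perm V) : ∑ i, f (τ i) i = ∑ j, f j (τ⁻¹ j) := by
  rw [← Equiv.sum_comp τ⁻¹ (fun i => f (τ i) i)]
  simp

omit [DecidableEq V] in
/-- **INVERSION DUALITY.**  If `σ` is the unique maximiser of the score `∑ (w i (τ i) + θ g i (τ i))` among present covers, then `σ⁻¹` is the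
unique maximiser of the transposed score (arc data `okᵀ, wᵀ, gᵀ`). [folklore] -/
theorem isMax_inv (ok : V → V → Prop) (w g : V → V → ℤ) (θ : ℤ) (σ : Equiv.Perm V)
    (h : (∀ i, ok i (σ i)) ∧ ∀ τ : Equiv.Perm V, τ ≠ σ → (∀ i, ok i (τ i)) →
      ∑ i, (w i (τ i) + θ * g i (τ i)) < ∑ i, (w i (σ i) + θ * g i (σ i))) :
    (∀ i, (fun i j => ok j i) i (σ⁻¹ i)) ∧ ∀ τ : Equiv.Perm V, τ ≠ σ⁻¹ → (∀ i, (fun i j => ok j i) i (τ i)) →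
      ∑ i, ((fun i j => w j i) i (τ i) + θ * (fun i j => g j i) i (τ i)) <
        ∑ i, ((fun i j => w j i) i (σ⁻¹ i) + θ * (fun i j => g j i) i (σ⁻¹ i)) := by
  refine ⟨fun i => by simpa using h.1 (σ⁻¹ i), fun τ hτ hok => ?_⟩
  have hτ' : τ⁻¹ ≠ σ := fun h' => hτ (by rw [← h', inv_inv])
  have hok' : ∀ i, ok i (τ⁻¹ i) := fun i => by simpa using hok (τ⁻¹ i)
  have key := h.2 τ⁻¹ hτ' hok'
  have e1 : ∑ i, (w (τ i) i + θ * g (τ i) i) = ∑ i, (w i (τ⁻¹ i) + θ * g i (τ⁻¹ i)) :=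
    sum_transpose (fun a c => w a c + θ * g a c) τ
  have e2 : ∑ i, (w (σ⁻¹ i) i + θ * g (σ⁻¹ i) i) = ∑ i, (w i (σ i) + θ * g i (σ i)) := by
    rw [sum_transpose (fun a c => w a c + θ * g a c) σ⁻¹]; simp
  simp only
  rw [e1, e2]; exact key


section Core

variable (ok : V → V → Prop) (w g : V → V → ℤ) (b : Fin 5 → V)

omit [Fintype V] [DecidableEq V] in
/-- A fixed point of `σ` is a fixed point of `σ⁻¹` (as an `iff` on disequalities). [folklore] -/
theorem inv_fix_iff (σ : Equiv.Perm V) (v : V) : σ⁻¹ v = v ↔ σ v = v := by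
  rw [Equiv.Perm.inv_eq_iff_eq]; exact eq_comm

/-- **THEOREM K1-J, dual (Regime II) form.**  `core_K1J` applied to the inverted realisation (`isMax_inv`): in a realisation of the
nested-triangle core it is impossible that (i) `σZ b3` reaches `b0` by a rising walk along INVERSE relative arcs (`σZ⁻¹ j = σX⁻¹ i`,
`X = B, C, E`), (ii) `b1` is reachable from `b0` by such a walk, (iii) `σZ b1` reaches `b0` by such a walk with `X = B, E` only, and
(iv) `b1 = (σZ σB⁻¹)ᵏ b2` along a chain off the gates.  (In the forward picture: the mirror image of K1-J with «reachable from b0» and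
«reaching b0» exchanged and each mark `b_k` replaced by `σZ⁻¹ b_k`.) [this seat's theorem] -/
theorem core_K1J_inv (hb : Function.Injective b)
    (hoff : ∀ i j, j ≠ i → g i j = 0) (hmark : ∀ l, g (b l) (b l) = (2 : ℤ) ^ (l : ℕ)) (haux : ∀ i, (∀ l, b l ≠ i) → g i i = 0)
    {θB θC θE θZ : ℤ} {σB σC σE σZ : Equiv.Perm V} (hBC : θB < θC) (hCE : θC < θE) (hEZ : θE < θZ)
    (hB : (∀ i, ok i (σB i)) ∧ ∀ τ : Equiv.Perm V, τ ≠ σB → (∀ i, ok i (τ i)) →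
      ∑ i, (w i (τ i) + θB * g i (τ i)) < ∑ i, (w i (σB i) + θB * g i (σB i)))
    (hC : (∀ i, ok i (σC i)) ∧ ∀ τ : Equiv.Perm V, τ ≠ σC → (∀ i, ok i (τ i)) →
      ∑ i, (w i (τ i) + θC * g i (τ i)) < ∑ i, (w i (σC i) + θC * g i (σC i)))
    (hE : (∀ i, ok i (σE i)) ∧ ∀ τ : Equiv.Perm V, τ ≠ σE → (∀ i, ok i (τ i)) →
      ∑ i, (w i (τ i) + θE * g i (τ i)) < ∑ i, (w i (σE i) + θE * g i (σE i)))
    (hZ : (∀ i, ok i (σZ i)) ∧ ∀ τ : Equiv.Perm V, τ ≠ σZ → (∀ i, ok i (τ i)) →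
      ∑ i, (w i (τ i) + θZ * g i (τ i)) < ∑ i, (w i (σZ i) + θZ * g i (σZ i)))
    (hB0 : σB (b 0) ≠ b 0) (hB1 : σB (b 1) = b 1) (hB2 : σB (b 2) = b 2) (hB3 : σB (b 3) ≠ b 3) (hB4 : σB (b 4) ≠ b 4)
    (hC0 : σC (b 0) ≠ b 0) (hC1 : σC (b 1) = b 1) (hC2 : σC (b 2) ≠ b 2) (hC3 : σC (b 3) = b 3) (hC4 : σC (b 4) ≠ b 4)
    (hE0 : σE (b 0) ≠ b 0) (hE1 : σE (b 1) ≠ b 1) (hE2 : σE (b 2) = b 2) (hE3 : σE (b 3) = b 3) (hE4 : σE (b 4) ≠ b 4)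
    (hZ0 : σZ (b 0) = b 0) (hZ1 : σZ (b 1) ≠ b 1) (hZ2 : σZ (b 2) ≠ b 2) (hZ3 : σZ (b 3) ≠ b 3) (hZ4 : σZ (b 4) = b 4)
    (hr : Relation.TransGen (fun i j => i ≠ b 4 ∧ i ≠ b 0 ∧ j ≠ b 4 ∧ i ≠ j ∧
      (σZ⁻¹ j = σB⁻¹ i ∨ σZ⁻¹ j = σC⁻¹ i ∨ σZ⁻¹ j = σE⁻¹ i)) (σZ (b 3)) (b 0))
    (hp : Relation.TransGen (fun i j => i ≠ b 4 ∧ j ≠ b 4 ∧ j ≠ b 0 ∧ i ≠ j ∧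
      (σZ⁻¹ j = σB⁻¹ i ∨ σZ⁻¹ j = σC⁻¹ i ∨ σZ⁻¹ j = σE⁻¹ i)) (b 0) (b 1))
    (hp' : Relation.TransGen (fun i j => i ≠ b 4 ∧ i ≠ b 0 ∧ j ≠ b 4 ∧ i ≠ j ∧
      (σZ⁻¹ j = σB⁻¹ i ∨ σZ⁻¹ j = σE⁻¹ i)) (σZ (b 1)) (b 0))
    (hqp : ∃ k : ℕ, ((σZ * σB⁻¹) ^ k) (b 2) = b 1 ∧ ∀ i, i ≤ k → ((σZ * σB⁻¹) ^ i) (b 2) ≠ b 0 ∧ ((σZ * σB⁻¹) ^ i) (b 2) ≠ b 4) :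
    False := by
  have hB' := isMax_inv ok w g θB σB hB
  have hC' := isMax_inv ok w g θC σC hC
  have hE' := isMax_inv ok w g θE σE hE
  have hZ' := isMax_inv ok w g θZ σZ hZ
  have e1 : (σZ⁻¹)⁻¹ (b 3) = σZ (b 3) := by simp
  have e2 : (σZ⁻¹)⁻¹ (b 1) = σZ (b 1) := by simp
  have e3 : (σZ⁻¹)⁻¹ * σB⁻¹ = σZ * σB⁻¹ := by simp
  exact core_K1J (fun i j => ok j i) (fun i j => w j i) (fun i j => g j i) b hb (fun i j hji => hoff j i hji.symm) hmark
    (fun i hi => haux i hi) hBC hCE hEZ hB' hC' hE' hZ'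
    (fun h' => hB0 ((inv_fix_iff σB (b 0)).mp h'))
    ((inv_fix_iff σB (b 1)).mpr hB1)
    ((inv_fix_iff σB (b 2)).mpr hB2)
    (fun h' => hB3 ((inv_fix_iff σB (b 3)).mp h'))
    (fun h' => hB4 ((inv_fix_iff σB (b 4)).mp h'))
    (fun h' => hC0 ((inv_fix_iff σC (b 0)).mp h'))
    ((inv_fix_iff σC (b 1)).mpr hC1)
    (fun h' => hC2 ((inv_fix_iff σC (b 2)).mp h'))
    ((inv_fix_iff σC (b 3)).mpr hC3)
    (fun h' => hC4 ((inv_fix_iff σC (b 4)).mp h'))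
    (fun h' => hE0 ((inv_fix_iff σE (b 0)).mp h'))
    (fun h' => hE1 ((inv_fix_iff σE (b 1)).mp h'))
    ((inv_fix_iff σE (b 2)).mpr hE2)
    ((inv_fix_iff σE (b 3)).mpr hE3)
    (fun h' => hE4 ((inv_fix_iff σE (b 4)).mp h'))
    ((inv_fix_iff σZ (b 0)).mpr hZ0)
    (fun h' => hZ1 ((inv_fix_iff σZ (b 1)).mp h'))
    (fun h' => hZ2 ((inv_fix_iff σZ (b 2)).mp h'))
    (fun h' => hZ3 ((inv_fix_iff σZ (b 3)).mp h'))
    ((inv_fix_iff σZ (b 4)).mpr hZ4)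
    (by rw [e1]; exact hr) hp (by rw [e2]; exact hp') (by rw [e3]; exact hqp)

end Core

end Core
end MarkedEdge
end Summit.ValiantsHypothesis.ValiantsHypothesis.Theorems.KPlusLogSqLaw
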